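import Summits.RiemannHypothesis.RiemannHypothesis.Theorems.SemilocalSoninIneqTwisted
import Summits.RiemannHypothesis.RiemannHypothesis.Theorems.SoninDistance
import HarnessLib

/-!
# The semilocal operator obligation: refutation from a NEAR-Sonin vector (perturbation lemmas + bridge)

Cell `rh-explicit`, seat cc-s2-1 (HOME `run/shared/lean/pub/rh-explicit/`; lead ruling R5-1: "cc-s2-1 supplies the
analytic lemmas" of the Lean landing of `¬ SemilocalSoninIneqOn 2 b` from the archived finite certificates,
`HOME/cc-s2-3/CERT-PLAN.md` §5.5/§7, `EXTREMALS/S2-sonin-refute-0549`).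

A certificate consists of a test function `g` (CC's two moment conditions, support `[−b, b]`), the kernel
`k = g ⋆ g̃`, and an explicit EVEN function `η ∈ L²(ℝ)` vanishing on `[−1, 1]` whose band energy
`ε = ∫_{[−1,1]} |𝓕 η|²` is tiny — a NEAR-Sonin vector — together with exact values / enclosures of
`B = Re⟨η | ϑ(T_p k) η⟩`, `G = ‖θ_p η‖²`, `‖η‖`, `C ≥ Re(W_∞(k) − W_p(k))` and `K ≥ ‖T_p k‖_{L¹}`.  The tree's
one-vector criterion `not_semilocalSoninIneqOn_of_twisted_vector` needs an EXACT Sonin vector `ζ ∈ S(1,1)`.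
This file supplies the passage `η ↦ ζ`:

* kernel-side continuity (for mollifying `g`): `‖⟨ξ|ϑ(k₁)ξ⟩ − ⟨ξ|ϑ(k₂)ξ⟩‖ ≤ ‖k₁ − k₂‖_{L¹} ‖ξ‖²`
  (`norm_soninTraceForm_sub_kernel_le`);
* vector-side perturbation: `‖⟨ζ|ϑ(k)ζ⟩ − ⟨η|ϑ(k)η⟩‖ ≤ ‖k‖_{L¹} (‖ζ‖ + ‖η‖) ‖ζ − η‖`
  (`norm_soninTraceForm_sub_vector_le`), `|‖θ_pζ‖² − ‖θ_pη‖²| ≤ 4 (‖ζ‖ + ‖η‖) ‖ζ − η‖`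
  (`abs_norm_sq_primeTwist_sub_le`), `‖T_p k‖_{L¹} ≤ (1 + p⁻¹ + 2p^{−1/2}) ‖k‖_{L¹}`;
* **the bridge** `not_semilocalSoninIneqOn_of_near_vector`: if `ζ ∈ S(1,1)` is within `d < ‖η‖` of `η` and
  `C · (G + 4(2N + d)d) < B − K(2N + d)d` (`‖η‖ ≤ N`, `0 ≤ C`), the obligation `SemilocalSoninIneqOn p a` fails;
  and **`not_semilocalSoninIneqOn_of_nearSonin_vector`**: the same with `ζ` produced by the distance lemma
  `SoninDistance.exists_mem_soninSpace_norm_sub_sq_le` from a band-energy bound `Λ` (hypothesis `hband`, = seat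
  cc-s2-3's E1 theorem at `α = β = 1`) and `ε/(1 − Λ) ≤ d²`.

Positivity of `ξ ↦ ⟨ξ|ϑ(g⋆g̃)ξ⟩` (which would give the sharper `(√B − √(K)d)²` form) is deliberately NOT used:
with the archived witnesses `d ≈ 1.5·10⁻⁶` (b = 13/25) the crude bound costs `≈ 10⁻⁵·K` against a margin
`≈ 6·10⁻⁴`.  Proof-only file (no definitions, no named facts). [folklore]
-/

set_option linter.dupNamespace false  -- the mandated namespace repeats `RiemannHypothesis`

noncomputable section

open MeasureTheory Complex Set FourierTransform Filter
open scoped Real ComplexConjugate InnerProductSpace ENNReal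

namespace Summit.RiemannHypothesis.RiemannHypothesis

open Literature.NumberTheory.LFunctions Literature.NumberTheory.ConnesConsani2021

/-! ## Kernel-side continuity of the diagonal coefficient `⟨ξ | ϑ(k) ξ⟩` -/

/-- **`‖⟨ξ|ϑ(k₁)ξ⟩ − ⟨ξ|ϑ(k₂)ξ⟩‖ ≤ ‖k₁ − k₂‖_{L¹} · ‖ξ‖²`** — the diagonal coefficient
`soninTraceForm k ξ = ∫ k(τ)⟨ξ|ϑ(e^τ)ξ⟩dτ` is `L¹`-Lipschitz in the kernel (`|⟨ξ|ϑ(e^τ)ξ⟩| ≤ ‖ξ‖²`).  This is the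
Sonin-side input for replacing a non-smooth certificate test function by its mollifications. [folklore] -/
theorem norm_soninTraceForm_sub_kernel_le {k₁ k₂ : ℝ → ℂ} (hk₁ : Integrable k₁) (hk₂ : Integrable k₂)
    (ξ : Lp ℂ 2 (volume : Measure ℝ)) :
    ‖soninTraceForm k₁ ξ - soninTraceForm k₂ ξ‖ ≤ (∫ τ, ‖k₁ τ - k₂ τ‖) * ‖ξ‖ ^ 2 := by
  unfold soninTraceForm
  rw [← integral_sub (integrable_mul_scalingCoeff hk₁ ξ ξ) (integrable_mul_scalingCoeff hk₂ ξ ξ)]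
  have h : ∀ τ, k₁ τ * scalingCoeff ξ ξ τ - k₂ τ * scalingCoeff ξ ξ τ =
      (k₁ τ - k₂ τ) * scalingCoeff ξ ξ τ := fun τ => by ring
  simp_rw [h]
  calc ‖∫ τ, (k₁ τ - k₂ τ) * scalingCoeff ξ ξ τ‖
      ≤ ∫ τ, ‖(k₁ τ - k₂ τ) * scalingCoeff ξ ξ τ‖ := norm_integral_le_integral_norm _
    _ ≤ ∫ τ, ‖k₁ τ - k₂ τ‖ * ‖ξ‖ ^ 2 := by
        refine integral_mono_of_nonneg (Eventually.of_forall fun _ => norm_nonneg _)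
          ((hk₁.sub hk₂).norm.mul_const _) (Eventually.of_forall fun τ => ?_)
        simp only
        rw [norm_mul, sq]
        exact mul_le_mul_of_nonneg_left (norm_scalingCoeff_le ξ ξ τ) (norm_nonneg _)
    _ = (∫ τ, ‖k₁ τ - k₂ τ‖) * ‖ξ‖ ^ 2 := integral_mul_const _ _

/-! ## Vector-side perturbation -/

/-- Polarisation of the difference of diagonal scaling coefficients:
`⟨ζ|ϑ(e^τ)ζ⟩ − ⟨η|ϑ(e^τ)η⟩ = ⟨ζ − η|ϑ(e^τ)ζ⟩ + ⟨η|ϑ(e^τ)(ζ − η)⟩`. [folklore] -/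
theorem scalingCoeff_self_sub_self (ζ η : Lp ℂ 2 (volume : Measure ℝ)) (τ : ℝ) :
    scalingCoeff ζ ζ τ - scalingCoeff η η τ =
      scalingCoeff ((ζ - η : Lp ℂ 2 (volume : Measure ℝ)) : ℝ → ℂ) ζ τ
        + scalingCoeff η ((ζ - η : Lp ℂ 2 (volume : Measure ℝ)) : ℝ → ℂ) τ := by
  simp only [scalingCoeff_eq_inner, map_sub, inner_sub_left, inner_sub_right]
  ring

/-- `‖⟨ζ|ϑ(e^τ)ζ⟩ − ⟨η|ϑ(e^τ)η⟩‖ ≤ (‖ζ‖ + ‖η‖)‖ζ − η‖`. [folklore] -/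
theorem norm_scalingCoeff_self_sub_self_le (ζ η : Lp ℂ 2 (volume : Measure ℝ)) (τ : ℝ) :
    ‖scalingCoeff ζ ζ τ - scalingCoeff η η τ‖ ≤ (‖ζ‖ + ‖η‖) * ‖ζ - η‖ := by
  rw [scalingCoeff_self_sub_self]
  calc ‖scalingCoeff ((ζ - η : Lp ℂ 2 (volume : Measure ℝ)) : ℝ → ℂ) ζ τ
        + scalingCoeff η ((ζ - η : Lp ℂ 2 (volume : Measure ℝ)) : ℝ → ℂ) τ‖
      ≤ ‖scalingCoeff ((ζ - η : Lp ℂ 2 (volume : Measure ℝ)) : ℝ → ℂ) ζ τ‖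
        + ‖scalingCoeff η ((ζ - η : Lp ℂ 2 (volume : Measure ℝ)) : ℝ → ℂ) τ‖ := norm_add_le _ _
    _ ≤ ‖ζ - η‖ * ‖ζ‖ + ‖η‖ * ‖ζ - η‖ :=
        add_le_add (norm_scalingCoeff_le _ _ _) (norm_scalingCoeff_le _ _ _)
    _ = (‖ζ‖ + ‖η‖) * ‖ζ - η‖ := by ring

/-- **`‖⟨ζ|ϑ(k)ζ⟩ − ⟨η|ϑ(k)η⟩‖ ≤ ‖k‖_{L¹} (‖ζ‖ + ‖η‖) ‖ζ − η‖`** for `k ∈ L¹(ℝ)`. [folklore] -/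
theorem norm_soninTraceForm_sub_vector_le {k : ℝ → ℂ} (hk : Integrable k)
    (ζ η : Lp ℂ 2 (volume : Measure ℝ)) :
    ‖soninTraceForm k ζ - soninTraceForm k η‖ ≤ (∫ τ, ‖k τ‖) * ((‖ζ‖ + ‖η‖) * ‖ζ - η‖) := by
  unfold soninTraceForm
  rw [← integral_sub (integrable_mul_scalingCoeff hk ζ ζ) (integrable_mul_scalingCoeff hk η η)]
  have h : ∀ τ, k τ * scalingCoeff ζ ζ τ - k τ * scalingCoeff η η τ =
      k τ * (scalingCoeff ζ ζ τ - scalingCoeff η η τ) := fun τ => by ring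
  simp_rw [h]
  calc ‖∫ τ, k τ * (scalingCoeff ζ ζ τ - scalingCoeff η η τ)‖
      ≤ ∫ τ, ‖k τ * (scalingCoeff ζ ζ τ - scalingCoeff η η τ)‖ := norm_integral_le_integral_norm _
    _ ≤ ∫ τ, ‖k τ‖ * ((‖ζ‖ + ‖η‖) * ‖ζ - η‖) := by
        refine integral_mono_of_nonneg (Eventually.of_forall fun _ => norm_nonneg _)
          (hk.norm.mul_const _) (Eventually.of_forall fun τ => ?_)
        simp only
        rw [norm_mul]
        exact mul_le_mul_of_nonneg_left (norm_scalingCoeff_self_sub_self_le ζ η τ) (norm_nonneg _)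
    _ = (∫ τ, ‖k τ‖) * ((‖ζ‖ + ‖η‖) * ‖ζ - η‖) := integral_mul_const _ _

section Twist

variable (p : ℕ) [hp : Fact p.Prime]

/-- `‖θ_p ζ‖ ≤ 2‖ζ‖` (`θ_p = 1 − (1 − θ_p)` with `‖1 − θ_p‖ < 1`, tree `norm_one_sub_primeTwist_lt_one`). [folklore] -/
theorem norm_primeTwist_le_two_mul (ζ : Lp ℂ 2 (volume : Measure ℝ)) :
    ‖primeTwist p ζ‖ ≤ 2 * ‖ζ‖ := by
  have h1 : primeTwist p ζ = ζ - ((1 : Lp ℂ 2 (volume : Measure ℝ) →L[ℂ] Lp ℂ 2 (volume : Measure ℝ))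
      - primeTwist p) ζ := by
    rw [show ((1 : Lp ℂ 2 (volume : Measure ℝ) →L[ℂ] Lp ℂ 2 (volume : Measure ℝ)) - primeTwist p) ζ =
      ζ - primeTwist p ζ from rfl, sub_sub_cancel]
  have h2 : ‖((1 : Lp ℂ 2 (volume : Measure ℝ) →L[ℂ] Lp ℂ 2 (volume : Measure ℝ)) - primeTwist p) ζ‖
      ≤ ‖ζ‖ :=
    (ContinuousLinearMap.le_opNorm _ ζ).trans
      (mul_le_of_le_one_left (norm_nonneg ζ) (norm_one_sub_primeTwist_lt_one p).le)
  calc ‖primeTwist p ζ‖ = ‖ζ - ((1 : Lp ℂ 2 (volume : Measure ℝ) →L[ℂ] Lp ℂ 2 (volume : Measure ℝ))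
        - primeTwist p) ζ‖ := by rw [← h1]
    _ ≤ ‖ζ‖ + ‖((1 : Lp ℂ 2 (volume : Measure ℝ) →L[ℂ] Lp ℂ 2 (volume : Measure ℝ)) - primeTwist p) ζ‖ :=
        norm_sub_le _ _
    _ ≤ 2 * ‖ζ‖ := by linarith

/-- **`|‖θ_pζ‖² − ‖θ_pη‖²| ≤ 4 (‖ζ‖ + ‖η‖) ‖ζ − η‖`.** [folklore] -/
theorem abs_norm_sq_primeTwist_sub_le (ζ η : Lp ℂ 2 (volume : Measure ℝ)) :
    |‖primeTwist p ζ‖ ^ 2 - ‖primeTwist p η‖ ^ 2| ≤ 4 * ((‖ζ‖ + ‖η‖) * ‖ζ - η‖) := by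
  have h1 : ‖primeTwist p ζ‖ ^ 2 - ‖primeTwist p η‖ ^ 2 =
      (‖primeTwist p ζ‖ + ‖primeTwist p η‖) * (‖primeTwist p ζ‖ - ‖primeTwist p η‖) := by ring
  have h2 : |‖primeTwist p ζ‖ - ‖primeTwist p η‖| ≤ 2 * ‖ζ - η‖ :=
    (abs_norm_sub_norm_le _ _).trans (by rw [← map_sub]; exact norm_primeTwist_le_two_mul p _)
  have h3 : |‖primeTwist p ζ‖ + ‖primeTwist p η‖| ≤ 2 * (‖ζ‖ + ‖η‖) := by
    rw [abs_of_nonneg (by positivity)]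
    linarith [norm_primeTwist_le_two_mul p ζ, norm_primeTwist_le_two_mul p η]
  rw [h1, abs_mul]
  calc |‖primeTwist p ζ‖ + ‖primeTwist p η‖| * |‖primeTwist p ζ‖ - ‖primeTwist p η‖|
      ≤ (2 * (‖ζ‖ + ‖η‖)) * (2 * ‖ζ - η‖) :=
        mul_le_mul h3 h2 (abs_nonneg _) (by positivity)
    _ = 4 * ((‖ζ‖ + ‖η‖) * ‖ζ - η‖) := by ring

omit hp in
/-- The twisted kernel of an integrable kernel is integrable. [folklore] -/
theorem integrable_twistKernel {k : ℝ → ℂ} (hk : Integrable k) : Integrable (twistKernel p k) := by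
  have h1 : Integrable (fun τ : ℝ => k (τ - Real.log p)) := hk.comp_sub_right _
  have h2 : Integrable (fun τ : ℝ => k (τ + Real.log p)) := hk.comp_add_right _
  have h : twistKernel p k = fun τ => (1 + (p : ℂ)⁻¹) * k τ
      - (Real.exp (-(Real.log p / 2)) : ℂ) * (k (τ - Real.log p) + k (τ + Real.log p)) := rfl
  rw [h]
  exact (hk.const_mul _).sub ((h1.add h2).const_mul _)

omit hp in
/-- **`‖T_p k‖_{L¹} ≤ (1 + p⁻¹ + 2p^{−1/2}) ‖k‖_{L¹}`** (translation invariance of Lebesgue measure). [folklore] -/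
theorem integral_norm_twistKernel_le {k : ℝ → ℂ} (hk : Integrable k) :
    ∫ τ, ‖twistKernel p k τ‖ ≤
      (1 + (p : ℝ)⁻¹ + 2 * Real.exp (-(Real.log p / 2))) * ∫ τ, ‖k τ‖ := by
  have h1 : Integrable (fun τ : ℝ => k (τ - Real.log p)) := hk.comp_sub_right _
  have h2 : Integrable (fun τ : ℝ => k (τ + Real.log p)) := hk.comp_add_right _
  have hpt : ∀ τ, ‖twistKernel p k τ‖ ≤ (1 + (p : ℝ)⁻¹) * ‖k τ‖
      + Real.exp (-(Real.log p / 2)) * (‖k (τ - Real.log p)‖ + ‖k (τ + Real.log p)‖) := fun τ => by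
    have h : twistKernel p k τ = (1 + (p : ℂ)⁻¹) * k τ
        - (Real.exp (-(Real.log p / 2)) : ℂ) * (k (τ - Real.log p) + k (τ + Real.log p)) := rfl
    rw [h]
    have hc : ‖(1 + (p : ℂ)⁻¹)‖ = 1 + (p : ℝ)⁻¹ := by
      rw [show (1 + (p : ℂ)⁻¹) = ((1 + (p : ℝ)⁻¹ : ℝ) : ℂ) by push_cast; ring, Complex.norm_real,
        Real.norm_eq_abs, abs_of_nonneg (by positivity)]
    have he : ‖(Real.exp (-(Real.log p / 2)) : ℂ)‖ = Real.exp (-(Real.log p / 2)) := by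
      rw [Complex.norm_real, Real.norm_eq_abs, abs_of_pos (Real.exp_pos _)]
    calc _ ≤ ‖(1 + (p : ℂ)⁻¹) * k τ‖
          + ‖(Real.exp (-(Real.log p / 2)) : ℂ) * (k (τ - Real.log p) + k (τ + Real.log p))‖ :=
          norm_sub_le _ _
      _ ≤ _ := by
          rw [norm_mul, norm_mul, hc, he]
          gcongr
          exact norm_add_le _ _
  have n0 : Integrable (fun τ : ℝ => ‖k τ‖) := hk.norm
  have n1 : Integrable (fun τ : ℝ => ‖k (τ - Real.log p)‖) := h1.norm
  have n2 : Integrable (fun τ : ℝ => ‖k (τ + Real.log p)‖) := h2.norm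
  have i1 : Integrable (fun τ : ℝ => (1 + (p : ℝ)⁻¹) * ‖k τ‖) := n0.const_mul _
  have n12 : Integrable (fun τ : ℝ => ‖k (τ - Real.log p)‖ + ‖k (τ + Real.log p)‖) := n1.add n2
  have i2 : Integrable (fun τ : ℝ =>
      Real.exp (-(Real.log p / 2)) * (‖k (τ - Real.log p)‖ + ‖k (τ + Real.log p)‖)) := n12.const_mul _
  have hint : Integrable (fun τ => (1 + (p : ℝ)⁻¹) * ‖k τ‖
      + Real.exp (-(Real.log p / 2)) * (‖k (τ - Real.log p)‖ + ‖k (τ + Real.log p)‖)) := i1.add i2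
  calc ∫ τ, ‖twistKernel p k τ‖
      ≤ ∫ τ, ((1 + (p : ℝ)⁻¹) * ‖k τ‖
          + Real.exp (-(Real.log p / 2)) * (‖k (τ - Real.log p)‖ + ‖k (τ + Real.log p)‖)) :=
        integral_mono_of_nonneg (Eventually.of_forall fun _ => norm_nonneg _) hint
          (Eventually.of_forall hpt)
    _ = (1 + (p : ℝ)⁻¹) * (∫ τ, ‖k τ‖)
          + Real.exp (-(Real.log p / 2)) * ((∫ τ, ‖k (τ - Real.log p)‖) + (∫ τ, ‖k (τ + Real.log p)‖)) := by
        rw [integral_add i1 i2, integral_const_mul, integral_const_mul, integral_add n1 n2]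
    _ = (1 + (p : ℝ)⁻¹ + 2 * Real.exp (-(Real.log p / 2))) * ∫ τ, ‖k τ‖ := by
        rw [integral_sub_right_eq_self (fun τ => ‖k τ‖) (Real.log p),
          integral_add_right_eq_self (fun τ => ‖k τ‖) (Real.log p)]
        ring

/-! ## The bridge: refuting the obligation from a near-Sonin vector -/

/-- **Refutation of `SemilocalSoninIneqOn p a` from a NEAR-Sonin vector.**  Data: a Weil test `g` on `[−a, a]` with
CC's two conditions, `k = g ⋆ g̃`; a vector `η ∈ L²(ℝ)` and a Sonin vector `ζ ∈ S(1,1)` with `‖η − ζ‖ ≤ d < ‖η‖`;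
real numbers with `B ≤ Re⟨η|ϑ(T_p k)η⟩`, `‖θ_pη‖² ≤ G`, `‖η‖ ≤ N`, `Re(W_∞(k) − W_p(k)) ≤ C`, `0 ≤ C`,
`‖T_p k‖_{L¹} ≤ K`.  If `C·(G + 4(2N + d)d) < B − K(2N + d)d` then the obligation fails: the exact Sonin vector
`ζ ≠ 0` has `Re(W_∞ − W_p)(k)·‖θ_pζ‖² ≤ C(G + 4(2N+d)d) < B − K(2N+d)d ≤ Re⟨ζ|ϑ(T_p k)ζ⟩`, and
`not_semilocalSoninIneqOn_of_twisted_vector` applies. [folklore] -/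
theorem not_semilocalSoninIneqOn_of_near_vector {a : ℝ} {g : ℝ → ℂ}
    (hg : IsWeilTest g) (hsupp : tsupport g ⊆ Icc (-a) a)
    (h1 : mulFourier g (I / 2) = 0) (h0 : mulFourier g 0 = 0)
    {η ζ : Lp ℂ 2 (volume : Measure ℝ)} (hζ : ζ ∈ soninSpace 1 1)
    {d B G N C K : ℝ} (hd : ‖η - ζ‖ ≤ d) (hdη : d < ‖η‖)
    (hB : B ≤ (soninTraceForm (twistKernel p (weilConv g (weilReflect g))) (η : ℝ → ℂ)).re)
    (hG : ‖primeTwist p η‖ ^ 2 ≤ G) (hN : ‖η‖ ≤ N)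
    (hC : (archW (weilConv g (weilReflect g))
      - weilSemilocalPrimeTerm {p} (weilConv g (weilReflect g))).re ≤ C) (hC0 : 0 ≤ C)
    (hK : ∫ τ, ‖twistKernel p (weilConv g (weilReflect g)) τ‖ ≤ K)
    (hineq : C * (G + 4 * ((2 * N + d) * d)) < B - K * ((2 * N + d) * d)) :
    ¬ SemilocalSoninIneqOn p a := by
  set k : ℝ → ℂ := weilConv g (weilReflect g) with hk
  have hkint : Integrable k := integrable_weilConv_weilReflect hg
  have hTk : Integrable (twistKernel p k) := integrable_twistKernel p hkint
  have hd0 : 0 ≤ d := (norm_nonneg _).trans hd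
  -- `ζ ≠ 0`
  have hζ0 : ζ ≠ 0 := by
    intro h
    rw [h, sub_zero] at hd
    linarith
  -- size bookkeeping
  have hζη : ‖ζ - η‖ ≤ d := by rwa [norm_sub_rev]
  have hζN : ‖ζ‖ ≤ N + d := by
    calc ‖ζ‖ = ‖η + (ζ - η)‖ := by rw [add_sub_cancel]
      _ ≤ ‖η‖ + ‖ζ - η‖ := norm_add_le _ _
      _ ≤ N + d := add_le_add hN hζη
  have hprod : (‖ζ‖ + ‖η‖) * ‖ζ - η‖ ≤ (2 * N + d) * d :=
    mul_le_mul (by linarith) hζη (norm_nonneg _) (by linarith [norm_nonneg η])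
  -- the twisted norm at `ζ`
  have hGζ : ‖primeTwist p ζ‖ ^ 2 ≤ G + 4 * ((2 * N + d) * d) := by
    have h := abs_norm_sq_primeTwist_sub_le p ζ η
    have h' := (abs_le.mp h).2
    linarith
  -- the Sonin term at `ζ`
  have hBζ : B - K * ((2 * N + d) * d) ≤ (soninTraceForm (twistKernel p k) (ζ : ℝ → ℂ)).re := by
    have h := norm_soninTraceForm_sub_vector_le hTk ζ η
    have hre : |(soninTraceForm (twistKernel p k) (ζ : ℝ → ℂ)).re
        - (soninTraceForm (twistKernel p k) (η : ℝ → ℂ)).re| ≤ (∫ τ, ‖twistKernel p k τ‖) * ((‖ζ‖ + ‖η‖) * ‖ζ - η‖) := by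
      rw [← Complex.sub_re]
      exact (Complex.abs_re_le_norm _).trans h
    have hKK : (∫ τ, ‖twistKernel p k τ‖) * ((‖ζ‖ + ‖η‖) * ‖ζ - η‖) ≤ K * ((2 * N + d) * d) :=
      mul_le_mul hK hprod (by positivity) ((integral_nonneg fun _ => norm_nonneg _).trans hK)
    have h' := (abs_le.mp hre).1
    linarith
  -- the strict inequality at `ζ`
  refine not_semilocalSoninIneqOn_of_twisted_vector p hg hsupp h1 h0 hζ hζ0 ?_
  have hx : 0 ≤ ‖primeTwist p ζ‖ ^ 2 := by positivity
  calc (archW k - weilSemilocalPrimeTerm {p} k).re * ‖primeTwist p ζ‖ ^ 2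
      ≤ C * ‖primeTwist p ζ‖ ^ 2 := mul_le_mul_of_nonneg_right hC hx
    _ ≤ C * (G + 4 * ((2 * N + d) * d)) := mul_le_mul_of_nonneg_left hGζ hC0
    _ < B - K * ((2 * N + d) * d) := hineq
    _ ≤ (soninTraceForm (twistKernel p k) (ζ : ℝ → ℂ)).re := hBζ

/-- **Refutation of `SemilocalSoninIneqOn p a` from a near-Sonin vector and a band-energy bound** — the form a
finite certificate discharges by arithmetic.  `η` is a.e. even and vanishes a.e. on `[−1, 1]`; `Λ` is a band-energy
bound for the window pair `([−1,1], [−1,1])` (hypothesis `hband`: the tree's `SoninBandEnergy*` theorem of seat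
cc-s2-3 gives `Λ = 0.9999428`); `ε ≥ ∫_{[−1,1]}|𝓕η|²` and `ε/(1 − Λ) ≤ d²`, `0 ≤ d < ‖η‖`; the remaining data as in
`not_semilocalSoninIneqOn_of_near_vector`.  Then `¬ SemilocalSoninIneqOn p a` (the Sonin vector is supplied by
`SoninDistance.exists_mem_soninSpace_norm_sub_sq_le`). [folklore] -/
theorem not_semilocalSoninIneqOn_of_nearSonin_vector {a : ℝ} {g : ℝ → ℂ}
    (hg : IsWeilTest g) (hsupp : tsupport g ⊆ Icc (-a) a)
    (h1 : mulFourier g (I / 2) = 0) (h0 : mulFourier g 0 = 0)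
    {η : Lp ℂ 2 (volume : Measure ℝ)} (hev : η ∈ evenPart) (hvan : η ∈ vanishOn 1)
    {Λ : ℝ} (hΛ0 : 0 ≤ Λ) (hΛ1 : Λ < 1)
    (hband : ∀ f : Lp ℂ 2 (volume : Measure ℝ), (∀ᵐ x : ℝ, x ∉ Icc (-1 : ℝ) 1 → (f : ℝ → ℂ) x = 0) →
      ∫ x in Icc (-1 : ℝ) 1, ‖((𝓕 f : Lp ℂ 2 (volume : Measure ℝ)) : ℝ → ℂ) x‖ ^ 2 ≤ Λ * ‖f‖ ^ 2)
    {ε d B G N C K : ℝ}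
    (hε : ∫ x in Icc (-1 : ℝ) 1, ‖((𝓕 η : Lp ℂ 2 (volume : Measure ℝ)) : ℝ → ℂ) x‖ ^ 2 ≤ ε)
    (hdε : ε / (1 - Λ) ≤ d ^ 2) (hd0 : 0 ≤ d) (hdη : d < ‖η‖)
    (hB : B ≤ (soninTraceForm (twistKernel p (weilConv g (weilReflect g))) (η : ℝ → ℂ)).re)
    (hG : ‖primeTwist p η‖ ^ 2 ≤ G) (hN : ‖η‖ ≤ N)
    (hC : (archW (weilConv g (weilReflect g))
      - weilSemilocalPrimeTerm {p} (weilConv g (weilReflect g))).re ≤ C) (hC0 : 0 ≤ C)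
    (hK : ∫ τ, ‖twistKernel p (weilConv g (weilReflect g)) τ‖ ≤ K)
    (hineq : C * (G + 4 * ((2 * N + d) * d)) < B - K * ((2 * N + d) * d)) :
    ¬ SemilocalSoninIneqOn p a := by
  obtain ⟨ζ, hζ, hest⟩ :=
    SoninDistance.exists_mem_soninSpace_norm_sub_sq_le (α := 1) (β := 1) hΛ0 hΛ1 hband η hev hvan
  have h1Λ : 0 < 1 - Λ := by linarith
  have hd : ‖η - ζ‖ ≤ d := by
    have hsq : ‖η - ζ‖ ^ 2 ≤ d ^ 2 :=
      hest.trans ((div_le_div_of_nonneg_right hε h1Λ.le).trans hdε)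
    exact (pow_le_pow_iff_left₀ (norm_nonneg _) hd0 two_ne_zero).mp hsq
  exact not_semilocalSoninIneqOn_of_near_vector p hg hsupp h1 h0 hζ hd hdη hB hG hN hC hC0 hK hineq

end Twist

end Summit.RiemannHypothesis.RiemannHypothesis
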